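import Literature.Computability.QuantumComplexity.SegmentLayout
import Literature.Computability.Cryptography.KitaevBlockEmbedded
import Literature.Computability.Complexity.StackWords
import HarnessLib

/-!
# Register contents on a segment layout: labels from numbers, reading and writing a segment

Topic `Literature/Computability/QuantumComplexity`; sequel of `SegmentLayout.lean` for the discharge
of `VanDamSeroussi2002_gaussSumPhase_qsolvable`. The classical bookkeeping of the van Dam–Seroussi copy
tracks the CONTENT of every register (a natural number, least significant bit on the first wire of
the segment; the constant header segments are registers that are never written). This file turns a
content assignment `cfg : ℕ → ℕ` (segment `j` holds `cfg j`) into the basis label `lay segs cfg`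
and proves the two rules the symbolic execution uses:

* `SegLayout.bits w v` (the `w` low bits of `v`), `bitsToNat_bits`, `length_bits`, `getD_bits`;
* `SegLayout.exists_seg` / `segOf` / `offOf` (every wire lies in exactly one segment), `lay`,
  **`lay_emb`** and **`ofFn_lay_emb`** (reading segment `j` of `lay cfg` gives `bits (segs[j]) (cfg j)`);
* **`writeB_emb_lay`** — writing the bits of `v` on segment `j` (`QFTQubits.writeB`, as the oracle
  XOR blocks of `OracleXorRegister.lean` do) yields `lay (cfg[j ↦ v])`.

Everything is proved; no named fact.

## References

* M. A. Nielsen, I. L. Chuang, CUP 2010, §4.1 [NielsenChuang2010].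
-/

noncomputable section

namespace Literature.Computability.QuantumComplexity

namespace SegLayout

open Cryptography QFTQubits _root_.Computability Complexity

/-! ### Bits of a number -/

/-- The `w` low-order bits of `v`, least significant first. [folklore] -/
def bits (w v : ℕ) : List Bool := List.ofFn fun i : Fin w => v.testBit i

/-- `bits` has the requested length. [folklore] -/
@[simp] theorem length_bits (w v : ℕ) : (bits w v).length = w := by simp [bits]

/-- The entries of `bits`. [folklore] -/
theorem getD_bits (w v i : ℕ) : (bits w v).getD i false = (decide (i < w) && v.testBit i) := by
  unfold bits
  rw [List.getD_eq_getElem?_getD, List.getElem?_ofFn]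
  by_cases hi : i < w
  · simp [hi]
  · simp [hi]

/-- **The value of the low bits**: `bitsToNat (bits w v) = v mod 2^w`. [folklore] -/
theorem bitsToNat_bits (w v : ℕ) : bitsToNat (bits w v) = v % 2 ^ w := by
  apply Nat.eq_of_testBit_eq
  intro i
  rw [Complexity.testBit_bitsToNat_eq_getD, getD_bits, Nat.testBit_mod_two_pow]

/-- Below `2^w` the low bits determine the number. [folklore] -/
theorem bitsToNat_bits_of_lt {w v : ℕ} (hv : v < 2 ^ w) : bitsToNat (bits w v) = v := by
  rw [bitsToNat_bits, Nat.mod_eq_of_lt hv]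

/-- The bits of `0` are all `false`. [folklore] -/
theorem bits_zero (w : ℕ) : bits w 0 = List.replicate w false := by
  unfold bits
  rw [← List.ofFn_const]
  simp

variable (segs : List ℕ)

/-! ### Every wire lies in exactly one segment -/

/-- `pre` of a cons list, one step in. [folklore] -/
theorem pre_cons_succ (a : ℕ) (rest : List ℕ) (j : ℕ) : pre (a :: rest) (j + 1) = a + pre rest j := by
  simp [pre, List.take_succ_cons, List.sum_cons]

/-- **Every wire lies in some segment.** [folklore] -/
theorem exists_seg : ∀ (segs : List ℕ) (w : Fin segs.sum), ∃ j, j < segs.length ∧ ∃ i : Fin (segs.getD j 0), emb segs j i = w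
  | [], w => absurd w.isLt (by simp)
  | a :: rest, w => by
    by_cases hw : (w : ℕ) < a
    · exact ⟨0, by simp, ⟨w, by simpa using hw⟩, Fin.ext (by rw [emb_val, pre_zero, Nat.zero_add])⟩
    · have hw' : (w : ℕ) - a < rest.sum := by
        have := w.isLt; simp only [List.sum_cons] at this; omega
      obtain ⟨j, hj, i, hi⟩ := exists_seg rest ⟨w - a, hw'⟩
      refine ⟨j + 1, by simpa using hj, ⟨i, by simpa using i.isLt⟩, Fin.ext ?_⟩
      have hv := congrArg Fin.val hi
      simp only [emb_val] at hv
      rw [emb_val, pre_cons_succ]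
      simp only
      omega

variable {segs}

/-- The segment of a wire. [folklore] -/
def segOf (w : Fin segs.sum) : ℕ := Classical.choose (exists_seg segs w)

/-- The segment index is within the list. [folklore] -/
theorem segOf_lt (w : Fin segs.sum) : segOf w < segs.length := (Classical.choose_spec (exists_seg segs w)).1

/-- The offset of a wire in its segment (a Fin). [folklore] -/
def offFin (w : Fin segs.sum) : Fin (segs.getD (segOf w) 0) := Classical.choose (Classical.choose_spec (exists_seg segs w)).2

/-- A wire is the wire of its segment and offset. [folklore] -/
theorem emb_segOf_offFin (w : Fin segs.sum) : emb segs (segOf w) (offFin w) = w :=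
  Classical.choose_spec (Classical.choose_spec (exists_seg segs w)).2

/-- The offset of a wire in its segment, as a number: the wire number minus the segment start. [folklore] -/
def offOf (w : Fin segs.sum) : ℕ := (w : ℕ) - pre segs (segOf w)

/-- The offset is the value of the Fin offset. [folklore] -/
theorem offOf_eq_offFin (w : Fin segs.sum) : offOf w = (offFin w : ℕ) := by
  have h := congrArg Fin.val (emb_segOf_offFin w)
  rw [emb_val] at h
  unfold offOf
  omega

/-- The offset is within the segment. [folklore] -/
theorem offOf_lt (w : Fin segs.sum) : offOf w < segs.getD (segOf w) 0 := by
  rw [offOf_eq_offFin]; exact (offFin w).isLt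

/-- The wire number is segment start plus offset. [folklore] -/
theorem pre_add_offOf (w : Fin segs.sum) : pre segs (segOf w) + offOf w = w := by
  have h := congrArg Fin.val (emb_segOf_offFin w)
  rw [emb_val] at h
  rw [offOf_eq_offFin]
  exact h

/-- **The segment of `emb j i` is `j`.** [folklore] -/
theorem segOf_emb (j : ℕ) (i : Fin (segs.getD j 0)) : segOf (emb segs j i) = j := by
  by_contra h
  exact emb_ne segs h (offFin (emb segs j i)) i (emb_segOf_offFin _)

/-- **The offset of `emb j i` is `i`.** [folklore] -/
theorem offOf_emb (j : ℕ) (i : Fin (segs.getD j 0)) : offOf (emb segs j i) = i := by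
  unfold offOf
  rw [segOf_emb, emb_val]
  omega

/-! ### Labels from contents -/

/-- **The basis label of a content assignment**: segment `j` carries the low bits of `cfg j`.
[cite: NielsenChuang2010, §4.1] -/
def lay (cfg : ℕ → ℕ) : QReg segs.sum := fun w => (cfg (segOf w)).testBit (offOf w)

/-- **Reading a wire of segment `j`.** [folklore] -/
@[simp] theorem lay_emb (cfg : ℕ → ℕ) (j : ℕ) (i : Fin (segs.getD j 0)) : lay (segs := segs) cfg (emb segs j i) = (cfg j).testBit i := by
  unfold lay
  rw [offOf_emb, segOf_emb]

/-- **Reading segment `j`** gives the low bits of its content. [folklore] -/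
theorem ofFn_lay_emb (cfg : ℕ → ℕ) (j : ℕ) : List.ofFn (lay (segs := segs) cfg ∘ emb segs j) = bits (segs.getD j 0) (cfg j) := by
  unfold bits
  congr 1
  funext i
  exact lay_emb cfg j i

/-- Labels only depend on the contents of actual segments. [folklore] -/
theorem lay_congr {cfg cfg' : ℕ → ℕ} (h : ∀ j, j < segs.length → cfg j = cfg' j) : lay (segs := segs) cfg = lay cfg' := by
  funext w
  unfold lay
  rw [h _ (segOf_lt w)]

/-- **Writing the bits of `v` on segment `j` updates the content.** [folklore] -/
theorem writeB_emb_lay (cfg : ℕ → ℕ) (j v : ℕ) :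
    writeB (emb segs j) (lay (segs := segs) cfg) (fun i => v.testBit i) = lay (Function.update cfg j v) := by
  symm
  refine (KitaevEmb.eq_writeB_iff (emb segs j) (lay cfg) _ _).2 ⟨fun w hw => ?_, funext fun i => ?_⟩
  · have hj : segOf w ≠ j := by
      intro h
      apply hw
      refine ⟨⟨offOf w, by rw [← h]; exact offOf_lt w⟩, Fin.ext ?_⟩
      rw [emb_val]
      have hv := pre_add_offOf w
      rw [h] at hv
      exact hv
    unfold lay
    rw [Function.update_of_ne hj]
  · show lay (Function.update cfg j v) (emb segs j i) = v.testBit i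
    rw [lay_emb, Function.update_self]

/-- Clearing segment `j`. [folklore] -/
theorem writeB_emb_lay_zero (cfg : ℕ → ℕ) (j : ℕ) :
    writeB (emb segs j) (lay (segs := segs) cfg) (fun _ => false) = lay (Function.update cfg j 0) := by
  rw [← writeB_emb_lay cfg j 0]
  simp

end SegLayout

end Literature.Computability.QuantumComplexity

end
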